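import Mathlib
import Summits.NavierStokesRegularity.NavierStokesRegularity.Theorems.ScenarioCensusPeriodicSlabStreamCorrector
import Summits.NavierStokesRegularity.NavierStokesRegularity.Theorems.ScenarioCensusPeriodicSlabCutoffCoeff
import Summits.NavierStokesRegularity.NavierStokesRegularity.Theorems.ScenarioCensusPeriodicSlabWindow
import HarnessLib

/-!
# Census row S7 (c): the stream-function corrector `Ψ = Φ̃ J∇φ` and the corrector identity
# `∫_S P div Ψ = Σᵢ ∫_S ⟪∂ᵢU, ∂ᵢΨ⟫ + ∫_S ⟪(U·∇)U, Ψ⟫`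

Support file for the scenario census of `NavierStokesRegularity` (cell `pub/ns-census`, block S,
row S7 = Bang–Gui–Wang–Xie, J. Fluid Mech. 1005 (2025) A6 = arXiv:2205.13259, Thm 1.4 (c)). The
printed proof of case (c) (§5 Step 3) writes the cut-off pressure term as
`∫ P · r u^r = ∫ P div Ψ_R = −∫ ∇P · Ψ_R` for a Bogovskiĭ corrector `Ψ_R ∈ H¹₀` of the annular
period cell and then uses the momentum equation `∇P = Δu − (u·∇)u`. Here:

* `corrector_identity` — for a `C¹` axially periodic test field `Ψ` vanishing with its derivative
  off a cylinder and a smooth steady Navier–Stokes flow `(U, P)` at unit viscosity with `U`, `P`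
  axially `L`-periodic: `∫_S P div Ψ = Σᵢ ∫_S ⟪∂ᵢU, ∂ᵢΨ⟫ + ∫_S ⟪(U·∇)U, Ψ⟫` on one period
  `S = zSlab L 0` (whole-space identities of `WholeSpaceIBP` against `ω_L(x₂)² Ψ`, the window
  derivative terms vanish by `window_bookkeeping`);
* `streamCorrectorField` — the tree's corrector `Ψ(x) = Φ̃(x) W(x)`, `W = corrField r = J∇φ`,
  `Φ̃ = streamCorrector g`: `C¹`, `z`-invariant, `div Ψ = a ⟪x_h, g(x_h)⟫`
  (`divergence_streamCorrectorField`), and the pointwise bounds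
  `‖Ψ‖ ≤ |Φ̃| (C/r) χ`, `‖DΨ‖ ≤ (‖DΦ̃‖ C/r + |Φ̃| C/r²) χ` (`streamCorrectorField_bounds`).

No summit statement and no census row is proved in this file.

## References

* J. Bang, C. Gui, Y. Wang, C. Xie, arXiv:2205.13259, §5 Step 3, (4-19)–(4-20).
  [BangGuiWangXie2025]
-/

-- the summit and its single problem share the name (D-0017 nested layout)
set_option linter.dupNamespace false

noncomputable section

open MeasureTheory Set Function Filter InnerProductSpace
open scoped Topology RealInnerProductSpace Laplacian

namespace Summit.NavierStokesRegularity.NavierStokesRegularity.Theorems.ScenarioCensus.PeriodicSlab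

open Literature.Analysis Literature.Analysis.FluidPDE

/-! ### The corrector identity on one period -/

/-- **The corrector identity.** Let `U ∈ C²`, `P ∈ C¹` satisfy the steady Navier–Stokes momentum
equation at unit viscosity, `(U·∇)U = ΔU − ∇P`, with `U`, `P` axially `L`-periodic (`L > 0`), and
let `Ψ ∈ C¹` be axially `L`-periodic and vanish together with `DΨ` off the cylinder `{ρ < ρ₀}`.
Then on one period `S = zSlab L 0`, with `eᵢ` the standard basis,
`∫_S P div Ψ = Σᵢ ∫_S ⟪DU eᵢ, DΨ eᵢ⟫ + ∫_S ⟪(U·∇)U, Ψ⟫`. -/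
theorem corrector_identity {L : ℝ} (hL : 0 < L)
    {U Ψ : EuclideanSpace ℝ (Fin 3) → EuclideanSpace ℝ (Fin 3)} {P : EuclideanSpace ℝ (Fin 3) → ℝ}
    (hU : ContDiff ℝ 2 U) (hP : ContDiff ℝ 1 P) (hΨ : ContDiff ℝ 1 Ψ)
    (hNS : ∀ x, convect U U x = (Δ U) x - gradient P x)
    (hUper : IsAxiallyPeriodic L U) (hPper : IsAxiallyPeriodic L P) (hΨper : IsAxiallyPeriodic L Ψ)
    {ρ₀ : ℝ} (hΨ0 : ∀ x, ρ₀ ≤ cylRadius x → Ψ x = 0)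
    (hDΨ0 : ∀ x, ρ₀ ≤ cylRadius x → fderiv ℝ Ψ x = 0) :
    ∫ x in zSlab L 0, P x * VectorCalculus.divergence Ψ x =
      (∑ i, ∫ x in zSlab L 0, ⟪fderiv ℝ U x (EuclideanSpace.basisFun (Fin 3) ℝ i),
          fderiv ℝ Ψ x (EuclideanSpace.basisFun (Fin 3) ℝ i)⟫) +
        ∫ x in zSlab L 0, ⟪convect U U x, Ψ x⟫ := by
  set b := EuclideanSpace.basisFun (Fin 3) ℝ with hb
  set ω2 : ℝ → ℝ := fun s => periodicWindow L s ^ 2 with hω2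
  set Φ : EuclideanSpace ℝ (Fin 3) → EuclideanSpace ℝ (Fin 3) := fun x => ω2 (x 2) • Ψ x with hΦ
  set π₂ : EuclideanSpace ℝ (Fin 3) →L[ℝ] ℝ := EuclideanSpace.proj (2 : Fin 3) with hπ₂
  have hπ₂a : ∀ x : EuclideanSpace ℝ (Fin 3), π₂ x = x 2 := fun x => rfl
  -- regularity
  have hU1 : ContDiff ℝ 1 U := hU.of_le one_le_two
  have hUc : Continuous U := hU1.continuous
  have hPc : Continuous P := hP.continuous
  have hΨc : Continuous Ψ := hΨ.continuous
  have hDUc : Continuous (fderiv ℝ U) := hU1.continuous_fderiv one_ne_zero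
  have hDΨc : Continuous (fderiv ℝ Ψ) := hΨ.continuous_fderiv one_ne_zero
  have hΨd : ∀ x, DifferentiableAt ℝ Ψ x := fun x => hΨ.differentiable one_ne_zero x
  have hω2c : ContDiff ℝ 1 ω2 := contDiff_periodicWindow_sq L
  have hω2d : ∀ s, HasDerivAt ω2 (deriv ω2 s) s := fun s => (hω2c.differentiable one_ne_zero s).hasDerivAt
  have hcω : ContDiff ℝ 1 fun x : EuclideanSpace ℝ (Fin 3) => ω2 (x 2) := hω2c.comp π₂.contDiff
  have hp2 : ∀ x : EuclideanSpace ℝ (Fin 3), HasFDerivAt (fun y : EuclideanSpace ℝ (Fin 3) => y 2) π₂ x :=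
    fun x => π₂.hasFDerivAt
  have hcωD : ∀ x : EuclideanSpace ℝ (Fin 3), HasFDerivAt (fun y : EuclideanSpace ℝ (Fin 3) => ω2 (y 2))
      (deriv ω2 (x 2) • π₂) x := fun x => by
    have h := (hω2d (x 2)).comp_hasFDerivAt x (hp2 x)
    exact h
  have hΦ1 : ContDiff ℝ 1 Φ := hcω.smul hΨ
  -- compact support of the windowed test field
  have hΦzero : ∀ x : EuclideanSpace ℝ (Fin 3), ρ₀ + 2 * L < ‖x‖ → ω2 (x 2) = 0 ∨ Ψ x = 0 := by
    intro x hx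
    by_cases hw : ω2 (x 2) = 0
    · exact Or.inl hw
    · right
      have hz := abs_le_of_periodicWindow_sq_ne_zero hL (x 2) hw
      refine hΨ0 x ?_
      by_contra hr
      have h := norm_le_cylRadius_add_abs_apply_two x
      linarith [not_le.1 hr]
  have hΦc : HasCompactSupport Φ := by
    refine HasCompactSupport.intro (isCompact_closedBall (0 : EuclideanSpace ℝ (Fin 3)) (ρ₀ + 2 * L))
      fun x hx => ?_
    rw [mem_closedBall_zero_iff, not_le] at hx
    rcases hΦzero x hx with h | h
    · simp [hΦ, h]
    · simp [hΦ, h]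
  -- derivative and divergence of the windowed field
  have hDΦ : ∀ x v, fderiv ℝ Φ x v = ω2 (x 2) • fderiv ℝ Ψ x v + (deriv ω2 (x 2) * v 2) • Ψ x := by
    intro x v
    have h : HasFDerivAt Φ (ω2 (x 2) • fderiv ℝ Ψ x + (deriv ω2 (x 2) • π₂).smulRight (Ψ x)) x :=
      (hcωD x).smul (hΨd x).hasFDerivAt
    rw [h.fderiv]
    simp only [_root_.add_apply, _root_.smul_apply, ContinuousLinearMap.smulRight_apply, hπ₂a,
      smul_eq_mul]
  have hdivΦ : ∀ x, VectorCalculus.divergence Φ x =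
      ω2 (x 2) * VectorCalculus.divergence Ψ x + deriv ω2 (x 2) * (Ψ x) 2 := by
    intro x
    show VectorCalculus.divergence (fun y => ω2 (y 2) • Ψ y) x = _
    rw [divergence_smul_apply (hcω.differentiable one_ne_zero x) (hΨd x)]
    congr 1
    rw [real_inner_comm, inner_gradient_left, (hcωD x).fderiv]
    simp only [_root_.smul_apply, hπ₂a, smul_eq_mul]
  -- the whole-space identities
  have hpress := integral_inner_gradient_eq_neg_integral_mul_divergence hP hΦ1 hΦc
  have hgreen := integral_inner_laplacian_add_eq_zero b hU hΦ1 (Or.inr hΦc)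
  -- the momentum equation tested against `Φ`
  have hconv_int : Integrable (fun x => ⟪convect U U x, Φ x⟫) :=
    ((hDUc.clm_apply hUc).inner hΦ1.continuous).integrable_of_hasCompactSupport
      (hΦc.mono fun x hx => by
        rw [Function.mem_support] at hx ⊢
        contrapose! hx
        rw [hx, inner_zero_right])
  have hlap_int : Integrable (fun x => ⟪(Δ U) x, Φ x⟫) :=
    ((continuous_laplacian hU).inner hΦ1.continuous).integrable_of_hasCompactSupport
      (hΦc.mono fun x hx => by
        rw [Function.mem_support] at hx ⊢
        contrapose! hx
        rw [hx, inner_zero_right])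
  have hmom : ∫ x, ⟪gradient P x, Φ x⟫ = (∫ x, ⟪(Δ U) x, Φ x⟫) - ∫ x, ⟪convect U U x, Φ x⟫ := by
    rw [← integral_sub hlap_int hconv_int]
    refine integral_congr_ae (Eventually.of_forall fun x => ?_)
    show ⟪gradient P x, Φ x⟫ = ⟪(Δ U) x, Φ x⟫ - ⟪convect U U x, Φ x⟫
    have e : gradient P x = (Δ U) x - convect U U x := by rw [hNS x]; abel
    rw [e, inner_sub_left]
  -- bookkeeping: (0) pressure densities
  have hdivc : Continuous (VectorCalculus.divergence Ψ) := continuous_divergence hDΨc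
  have hdivper : IsAxiallyPeriodic L (VectorCalculus.divergence Ψ) := fun x => by
    show LinearMap.trace ℝ _ _ = LinearMap.trace ℝ _ _
    rw [isAxiallyPeriodic_fderiv hΨper x]
  have hDΨper : IsAxiallyPeriodic L (fderiv ℝ Ψ) := isAxiallyPeriodic_fderiv hΨper
  have hDUper : IsAxiallyPeriodic L (fderiv ℝ U) := isAxiallyPeriodic_fderiv hUper
  have hdiv0 : ∀ x, ρ₀ ≤ cylRadius x → VectorCalculus.divergence Ψ x = 0 := fun x hx => by
    rw [VectorCalculus.divergence, hDΨ0 x hx]; simp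
  obtain ⟨c0, -, i0, -⟩ := window_bookkeeping hL (Q := fun x => P x * VectorCalculus.divergence Ψ x)
    (hPc.mul hdivc) (fun x => by simp only [hPper x, hdivper x]) (ρ := ρ₀)
    (fun x hx => by rw [hdiv0 x hx, mul_zero])
  obtain ⟨-, c0', -, i0'⟩ := window_bookkeeping hL (Q := fun x => P x * (Ψ x) 2)
    (hPc.mul ((continuous_apply 2).comp ((PiLp.continuous_ofLp 2 _).comp hΨc)))
    (fun x => by simp only [hPper x, hΨper x]) (ρ := ρ₀)
    (fun x hx => by rw [hΨ0 x hx]; simp)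
  have e0 : ∫ x, P x * VectorCalculus.divergence Φ x = ∫ x in zSlab L 0, P x * VectorCalculus.divergence Ψ x := by
    rw [← c0, ← add_zero (∫ x, P x * _ * _), ← c0', ← integral_add i0 i0']
    refine integral_congr_ae (Eventually.of_forall fun x => ?_)
    simp only [hdivΦ]; ring
  -- (1) the Green terms
  have e1 : ∀ i, ∫ x, ⟪fderiv ℝ U x (b i), fderiv ℝ Φ x (b i)⟫ =
      ∫ x in zSlab L 0, ⟪fderiv ℝ U x (b i), fderiv ℝ Ψ x (b i)⟫ := by
    intro i
    obtain ⟨cA, -, iA, -⟩ := window_bookkeeping hL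
      (Q := fun x => ⟪fderiv ℝ U x (b i), fderiv ℝ Ψ x (b i)⟫)
      ((hDUc.clm_apply continuous_const).inner (hDΨc.clm_apply continuous_const))
      (fun x => by simp only [hDUper x, hDΨper x]) (ρ := ρ₀)
      (fun x hx => by rw [hDΨ0 x hx]; simp)
    obtain ⟨-, cB, -, iB⟩ := window_bookkeeping hL
      (Q := fun x => (b i) 2 * ⟪fderiv ℝ U x (b i), Ψ x⟫)
      (continuous_const.mul ((hDUc.clm_apply continuous_const).inner hΨc))
      (fun x => by simp only [hDUper x, hΨper x]) (ρ := ρ₀)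
      (fun x hx => by rw [hΨ0 x hx]; simp)
    rw [← cA, ← add_zero (∫ x, ⟪fderiv ℝ U x (b i), fderiv ℝ Ψ x (b i)⟫ * _), ← cB, ← integral_add iA iB]
    refine integral_congr_ae (Eventually.of_forall fun x => ?_)
    simp only [hDΦ, inner_add_right, real_inner_smul_right]
    ring
  -- (2) the convection term
  have e2 : ∫ x, ⟪convect U U x, Φ x⟫ = ∫ x in zSlab L 0, ⟪convect U U x, Ψ x⟫ := by
    obtain ⟨cA, -, -, -⟩ := window_bookkeeping hL (Q := fun x => ⟪convect U U x, Ψ x⟫)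
      ((hDUc.clm_apply hUc).inner hΨc)
      (fun x => by simp only [convect_apply, hDUper x, hUper x, hΨper x]) (ρ := ρ₀)
      (fun x hx => by rw [hΨ0 x hx, inner_zero_right])
    rw [← cA]
    refine integral_congr_ae (Eventually.of_forall fun x => ?_)
    simp only [hΦ, real_inner_smul_right]
    ring
  -- assemble
  have hfin : ∫ x, P x * VectorCalculus.divergence Φ x =
      (∑ i, ∫ x, ⟪fderiv ℝ U x (b i), fderiv ℝ Φ x (b i)⟫) + ∫ x, ⟪convect U U x, Φ x⟫ := by
    linarith
  rw [e0, e2] at hfin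
  simp_rw [e1] at hfin
  exact hfin

/-! ### The stream-function corrector `Ψ = Φ̃ W` -/

/-- The corrector potential is `C¹`. -/
theorem contDiff_streamCorrector {g : EuclideanSpace ℝ (Fin 3) → EuclideanSpace ℝ (Fin 3)}
    {Dg : EuclideanSpace ℝ (Fin 3) → (EuclideanSpace ℝ (Fin 3) →L[ℝ] EuclideanSpace ℝ (Fin 3))}
    (hg : ∀ y, HasFDerivAt g (Dg y) y) (hDgc : Continuous Dg) {G₀ K : ℝ}
    (hG₀ : ∀ y, ‖g y‖ ≤ G₀) (hK : ∀ y, ‖Dg y‖ ≤ K)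
    (htr : ∀ y, Dg y (EuclideanSpace.single 0 1) 0 + Dg y (EuclideanSpace.single 1 1) 1 = 0) :
    ContDiff ℝ 1 (streamCorrector g) := by
  obtain ⟨hd, hc, -, -⟩ := streamCorrector_deriv hg hDgc hG₀ hK htr
  exact contDiff_one_iff_fderiv.2 ⟨hd, hc⟩

/-- **The stream-function corrector** `Ψ(x) = Φ̃(x) W(x)` of radius `r` for the planar field `g`:
`Φ̃ = streamCorrector g` (bounded potential with angular derivative `⟪x_h, g(x_h)⟫`),
`W = corrField r = J∇φ` (rotation field of the dyadic cut-off). -/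
def streamCorrectorField (g : EuclideanSpace ℝ (Fin 3) → EuclideanSpace ℝ (Fin 3)) (r : ℝ)
    (x : EuclideanSpace ℝ (Fin 3)) : EuclideanSpace ℝ (Fin 3) :=
  streamCorrector g x • corrField r x

/-- The corrector potential only sees the horizontal part: `Φ̃(x + t e₃) = Φ̃(x)`. -/
theorem streamCorrector_add_smul_eZ (g : EuclideanSpace ℝ (Fin 3) → EuclideanSpace ℝ (Fin 3))
    (x : EuclideanSpace ℝ (Fin 3)) (t : ℝ) : streamCorrector g (x + t • eZ) = streamCorrector g x := by
  simp only [streamCorrector, streamPotential, refRadius, horizPart_add_smul_eZ]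

/-- `Ψ` is invariant under axial translations (hence axially periodic of every period). -/
theorem streamCorrectorField_add_smul_eZ (g : EuclideanSpace ℝ (Fin 3) → EuclideanSpace ℝ (Fin 3))
    (r : ℝ) (x : EuclideanSpace ℝ (Fin 3)) (t : ℝ) :
    streamCorrectorField g r (x + t • eZ) = streamCorrectorField g r x := by
  rw [streamCorrectorField, streamCorrectorField, streamCorrector_add_smul_eZ, corrField_add_smul_eZ]

/-- **Regularity, divergence and bounds of the corrector.** Under the hypotheses of
`hasFDerivAt_streamPotential` (`‖g‖ ≤ G₀`), for `r > 0` with the bounds `‖W‖ ≤ (C/r) χ`,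
`‖DW‖ ≤ (C/r²) χ` of `exists_corrField_bounds`: `Ψ = streamCorrectorField g r` is `C¹`, its
divergence is `div Ψ(x) = a(x) ⟪x_h, g(x_h)⟫`, and
`‖Ψ(x)‖ ≤ |Φ̃(x)| (C/r) χ(x)`, `‖DΨ(x)‖ ≤ (2 G₀ C/r + |Φ̃(x)| C/r²) χ(x)`. -/
theorem streamCorrectorField_props {g : EuclideanSpace ℝ (Fin 3) → EuclideanSpace ℝ (Fin 3)}
    {Dg : EuclideanSpace ℝ (Fin 3) → (EuclideanSpace ℝ (Fin 3) →L[ℝ] EuclideanSpace ℝ (Fin 3))}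
    (hg : ∀ y, HasFDerivAt g (Dg y) y) (hDgc : Continuous Dg) {G₀ K : ℝ}
    (hG₀ : ∀ y, ‖g y‖ ≤ G₀) (hK : ∀ y, ‖Dg y‖ ≤ K)
    (htr : ∀ y, Dg y (EuclideanSpace.single 0 1) 0 + Dg y (EuclideanSpace.single 1 1) 1 = 0)
    {r C : ℝ} (hr : 0 < r) (hC : 0 ≤ C)
    (hW : ∀ x, ‖corrField r x‖ ≤
      C / r * {x | r ≤ cylRadius x ∧ cylRadius x < 2 * r}.indicator (fun _ => (1 : ℝ)) x)
    (hDW : ∀ x, ‖fderiv ℝ (corrField r) x‖ ≤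
      C / r ^ 2 * {x | r ≤ cylRadius x ∧ cylRadius x < 2 * r}.indicator (fun _ => (1 : ℝ)) x) :
    ContDiff ℝ 1 (streamCorrectorField g r) ∧
      (∀ x, VectorCalculus.divergence (streamCorrectorField g r) x =
        dyCoeff r x * ⟪horizPart x, g (horizPart x)⟫) ∧
      (∀ x, ‖streamCorrectorField g r x‖ ≤ |streamCorrector g x| * (C / r) *
        {x | r ≤ cylRadius x ∧ cylRadius x < 2 * r}.indicator (fun _ => (1 : ℝ)) x) ∧
      ∀ x, ‖fderiv ℝ (streamCorrectorField g r) x‖ ≤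
        (2 * G₀ * (C / r) + |streamCorrector g x| * (C / r ^ 2)) *
          {x | r ≤ cylRadius x ∧ cylRadius x < 2 * r}.indicator (fun _ => (1 : ℝ)) x := by
  set Φt := streamCorrector g with hΦt
  set W := corrField r with hWdef
  set χ := {x | r ≤ cylRadius x ∧ cylRadius x < 2 * r}.indicator (fun _ => (1 : ℝ)) with hχ
  have hχnn : ∀ x, 0 ≤ χ x := fun x => Set.indicator_nonneg (fun _ _ => zero_le_one) x
  obtain ⟨hΦd, hΦc, hΦb, hΦang⟩ := streamCorrector_deriv hg hDgc hG₀ hK htr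
  have hΦ1 : ContDiff ℝ 1 Φt := contDiff_one_iff_fderiv.2 ⟨hΦd, hΦc⟩
  have hW1 : ContDiff ℝ 1 W := contDiff_corrField r
  have hWd : ∀ x, DifferentiableAt ℝ W x := fun x => hW1.differentiable one_ne_zero x
  have hG₀0 : 0 ≤ G₀ := (norm_nonneg _).trans (hG₀ 0)
  have hDΨ : ∀ x v, fderiv ℝ (streamCorrectorField g r) x v =
      (fderiv ℝ Φt x v) • W x + Φt x • fderiv ℝ W x v := by
    intro x v
    have h : HasFDerivAt (streamCorrectorField g r)
        (Φt x • fderiv ℝ W x + (fderiv ℝ Φt x).smulRight (W x)) x :=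
      (hΦd x).hasFDerivAt.smul (hWd x).hasFDerivAt
    rw [h.fderiv]
    simp only [_root_.add_apply, _root_.smul_apply, ContinuousLinearMap.smulRight_apply]
    rw [add_comm]
  refine ⟨hΦ1.smul hW1, fun x => ?_, fun x => ?_, fun x => ?_⟩
  · -- divergence
    show VectorCalculus.divergence (fun y => Φt y • W y) x = _
    rw [divergence_smul_apply (hΦd x) (hWd x), hWdef, divergence_corrField, mul_zero, zero_add,
      real_inner_comm, inner_gradient_left, corrField, map_smul, smul_eq_mul, hΦang x]
  · -- size
    show ‖Φt x • W x‖ ≤ _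
    rw [norm_smul, Real.norm_eq_abs, mul_assoc]
    exact mul_le_mul_of_nonneg_left (hW x) (abs_nonneg _)
  · -- derivative
    refine ContinuousLinearMap.opNorm_le_bound _ (mul_nonneg (by positivity) (hχnn x)) fun v => ?_
    rw [hDΨ x v]
    have h1 : ‖fderiv ℝ Φt x v • W x‖ ≤ 2 * G₀ * (C / r) * χ x * ‖v‖ := by
      rw [norm_smul, Real.norm_eq_abs]
      have ha : |fderiv ℝ Φt x v| ≤ 2 * G₀ * ‖v‖ := by
        rw [← Real.norm_eq_abs]
        exact (ContinuousLinearMap.le_opNorm _ _).trans (mul_le_mul_of_nonneg_right (hΦb x) (norm_nonneg _))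
      calc |fderiv ℝ Φt x v| * ‖W x‖ ≤ (2 * G₀ * ‖v‖) * (C / r * χ x) :=
            mul_le_mul ha (hW x) (norm_nonneg _) (by positivity)
        _ = 2 * G₀ * (C / r) * χ x * ‖v‖ := by ring
    have h2 : ‖Φt x • fderiv ℝ W x v‖ ≤ |Φt x| * (C / r ^ 2) * χ x * ‖v‖ := by
      rw [norm_smul, Real.norm_eq_abs]
      have hb : ‖fderiv ℝ W x v‖ ≤ C / r ^ 2 * χ x * ‖v‖ :=
        (ContinuousLinearMap.le_opNorm _ _).trans (mul_le_mul_of_nonneg_right (hDW x) (norm_nonneg _))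
      calc |Φt x| * ‖fderiv ℝ W x v‖ ≤ |Φt x| * (C / r ^ 2 * χ x * ‖v‖) :=
            mul_le_mul_of_nonneg_left hb (abs_nonneg _)
        _ = |Φt x| * (C / r ^ 2) * χ x * ‖v‖ := by ring
    calc ‖fderiv ℝ Φt x v • W x + Φt x • fderiv ℝ W x v‖
        ≤ ‖fderiv ℝ Φt x v • W x‖ + ‖Φt x • fderiv ℝ W x v‖ := norm_add_le _ _
      _ ≤ 2 * G₀ * (C / r) * χ x * ‖v‖ + |Φt x| * (C / r ^ 2) * χ x * ‖v‖ := add_le_add h1 h2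
      _ = (2 * G₀ * (C / r) + |Φt x| * (C / r ^ 2)) * χ x * ‖v‖ := by ring

end Summit.NavierStokesRegularity.NavierStokesRegularity.Theorems.ScenarioCensus.PeriodicSlab

end
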